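import Literature.Geometry.Lorentzian.ParametricAnnulusGluingProofs
import Literature.Geometry.Lorentzian.ParametricAnnulusGluingReassembly
import HarnessLib

/-!
# `ChruscielDelay_parametricAnnulusGluing` from its coordinate core on an annulus of `ℝ³`

Topic `Literature/Geometry/Lorentzian`. Everything here is PROVED; no definition, no statement of
`Prop` type is introduced (the analytic core below is a HYPOTHESIS of the reduction theorem,
spelled out in place; it is not vendored as a named fact, D-0026).

`ParametricAnnulusGluingProofs.lean` reduces the named fact `ChruscielDelay_parametricAnnulusGluing`
(`ParametricAnnulusGluing.lean`; Chruściel–Delay 2003, Thm. 5.9 / Prop. 5.10 / Cor. 5.11 and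
§8.6; 2004, Thm. 6.6) to the local, un-squashed family; `ParametricAnnulusGluingChart.lean` reads
data and families of data on the end `e` through its chart `Φ = e.dataChart`;
`ParametricAnnulusGluingReassembly.lean` transports far coordinate families back to `X`. What is
left is ONE statement about COORDINATE fields on the open annulus `A = {R₁ < ‖z‖ < R₂}` of `E3`,
the analytic content of the printed proof, and this file proves

  `(A) ⟹ ChruscielDelay_parametricAnnulusGluing`
  (`ChruscielDelay_parametricAnnulusGluing_of_coordCore`), where

* `(A)` (Chruściel–Delay 2003, Thm. 5.9 with Prop. 5.10 and Cor. 5.11 on a closed sub-annulus,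
  §8.6 pp. 52–54 for the one-parameter family, and the 2004 paper, Thm. 6.6, for the `C^∞`
  dependence on the parameter — in one chart): for a family `(S c, T c)`, `c ∈ ℝ¹`, of smooth
  symmetric coordinate fields on `A`, `S c` positive definite, jointly `C^∞` on `ℝ¹ × A`, each
  solving the coordinate vacuum constraints `hamAt (S c) (T c) = 0`, `momFn (S c) (T c) = 0` on `A`,
  and such that `(S 0, T 0)` has NO smooth coordinate KID on `A` (no smooth `(N, Y)` on `A` solving
  the symmetrised KID equations `DH*_γ N + DM*ˢ_γ Y = 0 = DH*_κ N + DM*ˢ_κ Y` other than `(0, 0)`),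
  there are `r > 0`, radii `R₁ < ρ₁ < ρ₂ < R₂` and a family `(S' c, T' c)`, `c ∈ ball 0 r`, jointly
  `C^∞` on `ball 0 r × A`, symmetric, `S' c` positive definite, solving the coordinate vacuum
  constraints on `A`, through `(S 0, T 0)` at `c = 0`, equal to `(S c, T c)` on `{R₁ < ‖z‖ < ρ₁}`
  and to `(S 0, T 0)` on `{ρ₂ < ‖z‖ < R₂}`.

The proof: the chart components `(S c, T c) := (hCoeff e (F c), kCoeff e (F c))` of the given
family are such coordinate data on `A ⊆ {e.R < ‖z‖}` (`contDiffOn_hCoeff_family`, `hCoeff_pos'`,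
`coordVacuum_of_isVacuum`), KID-free at `c = 0` by the hypothesis of the fact (`F 0 = D`); `(A)`
produces `(S', T')`; `AFEnd.exists_farCoordFamily_of_annulusFamily` glues `S' c` (inside radius
`(ρ₂ + R₂)/2`) with the chart components of `D` (beyond; the two agree on `{ρ₂ < ‖z‖ < R₂}`) into
fields `(H c, HK c)` which are jointly smooth, symmetric, positive and coordinate-vacuum on
`ball 0 r × {R₁ < ‖z‖}` (locality of `hamAt`, `momFn`, `CoordConstraintCongr.lean`);
`AFEnd.exists_localGluingFamily_of_farCoordFamily` patches them into `F c` beyond radius `R₁`;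
the squash of `ParametricAnnulusGluingProofs.lean` concludes.

## References

* P. T. Chruściel, E. Delay, Mém. Soc. Math. Fr. 94 (2003), Thm. 5.9, Prop. 5.10, Cor. 5.11,
  §8.6 (pp. 52–54). [ChruscielDelay2003]
* P. T. Chruściel, E. Delay, J. Geom. Phys. 51 (2004), Thm. 6.6. [ChruscielDelay2004]
* R. Bartnik, J. Isenberg, *The constraint equations* (2004), §2. [BartnikIsenberg2004]
-/

noncomputable section

set_option maxSynthPendingDepth 3

open Bundle Set Function Filter TopologicalSpace Manifold Module Metric
open scoped Manifold ContDiff Topology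

namespace Literature.Geometry.Lorentzian

namespace AFEnd

variable {X : Type} [TopologicalSpace X] [ChartedSpace E3 X] [IsManifold (𝓡 3) ∞ X]

/-- **Gluing an annulus family to the chart components of the base datum.** Let `D` be a vacuum
datum, `e.R ≤ R₁ < ρ₁ < ρ₂ < R₂`, `r > 0`, and `(S c, T c)`, `c ∈ ball 0 r`, coordinate fields which
on `ball 0 r × {R₁ < ‖z‖ < R₂}` are jointly `C^∞`, symmetric, `S c` positive definite and
coordinate-vacuum, with `(S 0, T 0) = (h_ij, k_ij)(D)` on the annulus, `(S c, T c) = (Q c, QK c)` on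
`{R₁ < ‖z‖ < ρ₁}` and `= (h_ij, k_ij)(D)` on `{ρ₂ < ‖z‖ < R₂}`. Then the fields `H c := S c` inside
radius `(ρ₂ + R₂)/2`, `:= h_ij(D)` beyond (same for `HK`), have all these properties on the whole
far region `{R₁ < ‖z‖}` (the two prescriptions agree on the open overlap; the constraint operators
are local, `hamAt_congr_of_eventuallyEq`, `momFn_congr_of_eventuallyEq`), with `(H 0, HK 0)` and
`(H c, HK c)` for `ρ₂ < ‖z‖` equal to `(h_ij, k_ij)(D)`. [cite: ChruscielDelay2003, §8.6] -/
theorem exists_farCoordFamily_of_annulusFamily (e : AFEnd X) (D : InitialDataSet (𝓡 3) X)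
    (hvac : ∀ [D.metric.HasLeviCivita], D.IsVacuumConstraintSolution)
    (Q QK : EuclideanSpace ℝ (Fin 1) → E3 → E3 →L[ℝ] E3 →L[ℝ] ℝ)
    {R₁ ρ₁ ρ₂ R₂ r : ℝ} (hR₁ : e.R ≤ R₁) (h₁ : R₁ < ρ₁) (h₂ : ρ₁ < ρ₂) (h₃ : ρ₂ < R₂) (hr : 0 < r)
    {ι : Type*} [Fintype ι] (b : Basis ι ℝ E3)
    (S T : EuclideanSpace ℝ (Fin 1) → E3 → E3 →L[ℝ] E3 →L[ℝ] ℝ)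
    (hSs : ContDiffOn ℝ ∞ (fun p : EuclideanSpace ℝ (Fin 1) × E3 ↦ S p.1 p.2)
      (ball (0 : EuclideanSpace ℝ (Fin 1)) r ×ˢ {z : E3 | R₁ < ‖z‖ ∧ ‖z‖ < R₂}))
    (hTs : ContDiffOn ℝ ∞ (fun p : EuclideanSpace ℝ (Fin 1) × E3 ↦ T p.1 p.2)
      (ball (0 : EuclideanSpace ℝ (Fin 1)) r ×ˢ {z : E3 | R₁ < ‖z‖ ∧ ‖z‖ < R₂}))
    (hsym : ∀ c ∈ ball (0 : EuclideanSpace ℝ (Fin 1)) r, ∀ z : E3, R₁ < ‖z‖ → ‖z‖ < R₂ →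
      ∀ v w : E3, S c z v w = S c z w v ∧ T c z v w = T c z w v)
    (hpos : ∀ c ∈ ball (0 : EuclideanSpace ℝ (Fin 1)) r, ∀ z : E3, R₁ < ‖z‖ → ‖z‖ < R₂ →
      ∀ v : E3, v ≠ 0 → 0 < S c z v v)
    (hcv : ∀ c ∈ ball (0 : EuclideanSpace ℝ (Fin 1)) r, ∀ z : E3, R₁ < ‖z‖ → ‖z‖ < R₂ →
      MetricCoord.hamAt (S c) (T c) z = 0 ∧ ∀ Z : E3, MetricCoord.momFn b (S c) (T c) z Z = 0)
    (h0 : ∀ z : E3, R₁ < ‖z‖ → ‖z‖ < R₂ → S 0 z = hCoeff e D z ∧ T 0 z = kCoeff e D z)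
    (hin : ∀ c ∈ ball (0 : EuclideanSpace ℝ (Fin 1)) r, ∀ z : E3, R₁ < ‖z‖ → ‖z‖ < ρ₁ →
      S c z = Q c z ∧ T c z = QK c z)
    (hout : ∀ c ∈ ball (0 : EuclideanSpace ℝ (Fin 1)) r, ∀ z : E3, ρ₂ < ‖z‖ → ‖z‖ < R₂ →
      S c z = hCoeff e D z ∧ T c z = kCoeff e D z) :
    ∃ H HK : EuclideanSpace ℝ (Fin 1) → E3 → E3 →L[ℝ] E3 →L[ℝ] ℝ,
      (∀ c ∈ ball (0 : EuclideanSpace ℝ (Fin 1)) r, ∀ z : E3, R₁ < ‖z‖ →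
        ContDiffAt ℝ ∞ (uncurry H) (c, z) ∧ ContDiffAt ℝ ∞ (uncurry HK) (c, z)) ∧
      (∀ c ∈ ball (0 : EuclideanSpace ℝ (Fin 1)) r, ∀ z : E3, R₁ < ‖z‖ → ∀ v w : E3,
        H c z v w = H c z w v ∧ HK c z v w = HK c z w v) ∧
      (∀ c ∈ ball (0 : EuclideanSpace ℝ (Fin 1)) r, ∀ z : E3, R₁ < ‖z‖ → ∀ v : E3,
        v ≠ 0 → 0 < H c z v v) ∧
      (∀ c ∈ ball (0 : EuclideanSpace ℝ (Fin 1)) r, ∀ z : E3, R₁ < ‖z‖ →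
        MetricCoord.hamAt (H c) (HK c) z = 0 ∧
          ∀ Z : E3, MetricCoord.momFn b (H c) (HK c) z Z = 0) ∧
      (∀ z : E3, R₁ < ‖z‖ → H 0 z = hCoeff e D z ∧ HK 0 z = kCoeff e D z) ∧
      (∀ c ∈ ball (0 : EuclideanSpace ℝ (Fin 1)) r, ∀ z : E3, R₁ < ‖z‖ → ‖z‖ < ρ₁ →
        H c z = Q c z ∧ HK c z = QK c z) ∧
      (∀ c ∈ ball (0 : EuclideanSpace ℝ (Fin 1)) r, ∀ z : E3, ρ₂ < ‖z‖ →
        H c z = hCoeff e D z ∧ HK c z = kCoeff e D z) := by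
  classical
  -- the gluing radius `ρ₂ < m < R₂`
  obtain ⟨m, hm₁, hm₂⟩ : ∃ m : ℝ, ρ₂ < m ∧ m < R₂ := ⟨(ρ₂ + R₂) / 2, by linarith, by linarith⟩
  refine ⟨fun c z ↦ if ‖z‖ < m then S c z else hCoeff e D z,
    fun c z ↦ if ‖z‖ < m then T c z else kCoeff e D z, ?_⟩
  -- on the annulus the glued fields are `(S, T)`; beyond `ρ₂` they are the chart components of `D`
  have hHA : ∀ c ∈ ball (0 : EuclideanSpace ℝ (Fin 1)) r, ∀ z : E3, R₁ < ‖z‖ → ‖z‖ < R₂ →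
      (if ‖z‖ < m then S c z else hCoeff e D z) = S c z ∧
        (if ‖z‖ < m then T c z else kCoeff e D z) = T c z := by
    intro c hc z hz1 hz2
    by_cases hzm : ‖z‖ < m
    · exact ⟨if_pos hzm, if_pos hzm⟩
    · obtain ⟨hS, hT⟩ := hout c hc z (by linarith [not_lt.1 hzm]) hz2
      exact ⟨(if_neg hzm).trans hS.symm, (if_neg hzm).trans hT.symm⟩
  have hHout : ∀ c ∈ ball (0 : EuclideanSpace ℝ (Fin 1)) r, ∀ z : E3, ρ₂ < ‖z‖ →
      (if ‖z‖ < m then S c z else hCoeff e D z) = hCoeff e D z ∧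
        (if ‖z‖ < m then T c z else kCoeff e D z) = kCoeff e D z := by
    intro c hc z hz
    by_cases hzm : ‖z‖ < m
    · obtain ⟨hS, hT⟩ := hout c hc z hz (by linarith)
      exact ⟨(if_pos hzm).trans hS, (if_pos hzm).trans hT⟩
    · exact ⟨if_neg hzm, if_neg hzm⟩
  have hRr : ∀ {z : E3}, R₁ < ‖z‖ → e.R < ‖z‖ := fun hz ↦ lt_of_le_of_lt hR₁ hz
  refine ⟨?_, ?_, ?_, ?_, ?_, ?_, fun c hc z hz ↦ hHout c hc z hz⟩
  · -- joint smoothness at the points of `ball × {R₁ < ‖z‖}`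
    intro c hc z hz1
    by_cases hz2 : ‖z‖ < R₂
    · have hO : IsOpen (ball (0 : EuclideanSpace ℝ (Fin 1)) r ×ˢ {w : E3 | R₁ < ‖w‖ ∧ ‖w‖ < R₂}) :=
        isOpen_ball.prod ((isOpen_lt continuous_const continuous_norm).inter
          (isOpen_lt continuous_norm continuous_const))
      have hmem : (c, z) ∈ ball (0 : EuclideanSpace ℝ (Fin 1)) r ×ˢ {w : E3 | R₁ < ‖w‖ ∧ ‖w‖ < R₂} :=
        ⟨hc, hz1, hz2⟩
      have hn := hO.mem_nhds hmem
      have hevS : (uncurry fun c z ↦ if ‖z‖ < m then S c z else hCoeff e D z) =ᶠ[𝓝 (c, z)]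
          fun p ↦ S p.1 p.2 := by
        filter_upwards [hn] with p hp
        exact (hHA p.1 hp.1 p.2 hp.2.1 hp.2.2).1
      have hevT : (uncurry fun c z ↦ if ‖z‖ < m then T c z else kCoeff e D z) =ᶠ[𝓝 (c, z)]
          fun p ↦ T p.1 p.2 := by
        filter_upwards [hn] with p hp
        exact (hHA p.1 hp.1 p.2 hp.2.1 hp.2.2).2
      exact ⟨((hSs _ hmem).contDiffAt hn).congr_of_eventuallyEq hevS,
        ((hTs _ hmem).contDiffAt hn).congr_of_eventuallyEq hevT⟩
    · have hz' : ρ₂ < ‖z‖ := by linarith [not_lt.1 hz2]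
      have hO : IsOpen (ball (0 : EuclideanSpace ℝ (Fin 1)) r ×ˢ {w : E3 | ρ₂ < ‖w‖}) :=
        isOpen_ball.prod (isOpen_lt continuous_const continuous_norm)
      have hn := hO.mem_nhds
        (show (c, z) ∈ ball (0 : EuclideanSpace ℝ (Fin 1)) r ×ˢ {w : E3 | ρ₂ < ‖w‖} from ⟨hc, hz'⟩)
      have hevS : (uncurry fun c z ↦ if ‖z‖ < m then S c z else hCoeff e D z) =ᶠ[𝓝 (c, z)]
          fun p ↦ hCoeff e D p.2 := by
        filter_upwards [hn] with p hp
        exact (hHout p.1 hp.1 p.2 hp.2).1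
      have hevT : (uncurry fun c z ↦ if ‖z‖ < m then T c z else kCoeff e D z) =ᶠ[𝓝 (c, z)]
          fun p ↦ kCoeff e D p.2 := by
        filter_upwards [hn] with p hp
        exact (hHout p.1 hp.1 p.2 hp.2).2
      have hz0 : e.R < ‖z‖ := by linarith
      have hDh := contDiffAt_hCoeff_family (e := e) (G := fun _ : EuclideanSpace ℝ (Fin 1) ↦ D)
        (D.h.contMDiff.comp contMDiff_snd) c hz0
      have hDk := contDiffAt_kCoeff_family (e := e) (G := fun _ : EuclideanSpace ℝ (Fin 1) ↦ D)
        (D.contMDiff_k.comp contMDiff_snd) c hz0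
      exact ⟨hDh.congr_of_eventuallyEq hevS, hDk.congr_of_eventuallyEq hevT⟩
  · -- symmetry
    intro c hc z hz1 v w
    beta_reduce
    by_cases hz2 : ‖z‖ < R₂
    · obtain ⟨hS, hT⟩ := hHA c hc z hz1 hz2
      rw [hS, hT]
      exact hsym c hc z hz1 hz2 v w
    · obtain ⟨hS, hT⟩ := hHout c hc z (by linarith [not_lt.1 hz2])
      rw [hS, hT]
      exact ⟨hCoeff_symm e D z v w, kCoeff_symm e D z v w⟩
  · -- positivity
    intro c hc z hz1 v hv
    beta_reduce
    by_cases hz2 : ‖z‖ < R₂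
    · rw [(hHA c hc z hz1 hz2).1]
      exact hpos c hc z hz1 hz2 v hv
    · rw [(hHout c hc z (by linarith [not_lt.1 hz2])).1]
      exact e.hCoeff_pos' D (hRr hz1) v hv
  · -- coordinate vacuum (locality of the constraint operators)
    intro c hc z hz1
    by_cases hz2 : ‖z‖ < R₂
    · have hO : IsOpen {w : E3 | R₁ < ‖w‖ ∧ ‖w‖ < R₂} :=
        (isOpen_lt continuous_const continuous_norm).inter (isOpen_lt continuous_norm continuous_const)
      have hevG : (fun z ↦ if ‖z‖ < m then S c z else hCoeff e D z) =ᶠ[𝓝 z] S c := by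
        filter_upwards [hO.mem_nhds ⟨hz1, hz2⟩] with w hw
        exact (hHA c hc w hw.1 hw.2).1
      have hevK : (fun z ↦ if ‖z‖ < m then T c z else kCoeff e D z) =ᶠ[𝓝 z] T c := by
        filter_upwards [hO.mem_nhds ⟨hz1, hz2⟩] with w hw
        exact (hHA c hc w hw.1 hw.2).2
      obtain ⟨hh, hmo⟩ := hcv c hc z hz1 hz2
      refine ⟨?_, fun Z ↦ ?_⟩
      · rw [MetricCoord.hamAt_congr_of_eventuallyEq hevG hevK]
        exact hh
      · rw [MetricCoord.momFn_congr_of_eventuallyEq b hevG hevK Z]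
        exact hmo Z
    · have hz' : ρ₂ < ‖z‖ := by linarith [not_lt.1 hz2]
      have hO : IsOpen {w : E3 | ρ₂ < ‖w‖} := isOpen_lt continuous_const continuous_norm
      have hevG : (fun z ↦ if ‖z‖ < m then S c z else hCoeff e D z) =ᶠ[𝓝 z] hCoeff e D := by
        filter_upwards [hO.mem_nhds hz'] with w hw
        exact (hHout c hc w hw).1
      have hevK : (fun z ↦ if ‖z‖ < m then T c z else kCoeff e D z) =ᶠ[𝓝 z] kCoeff e D := by
        filter_upwards [hO.mem_nhds hz'] with w hw
        exact (hHout c hc w hw).2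
      obtain ⟨hh, hmo⟩ := e.coordVacuum_of_isVacuum D hvac b (show e.R < ‖z‖ by linarith)
      refine ⟨?_, fun Z ↦ ?_⟩
      · rw [MetricCoord.hamAt_congr_of_eventuallyEq hevG hevK]
        exact hh
      · rw [MetricCoord.momFn_congr_of_eventuallyEq b hevG hevK Z]
        exact hmo Z
  · -- at `c = 0`
    intro z hz1
    by_cases hz2 : ‖z‖ < R₂
    · obtain ⟨hS, hT⟩ := hHA 0 (mem_ball_self hr) z hz1 hz2
      obtain ⟨hS', hT'⟩ := h0 z hz1 hz2
      exact ⟨hS.trans hS', hT.trans hT'⟩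
    · exact hHout 0 (mem_ball_self hr) z (by linarith [not_lt.1 hz2])
  · -- inside `ρ₁`
    intro c hc z hz1 hz2
    obtain ⟨hS, hT⟩ := hHA c hc z hz1 (by linarith)
    obtain ⟨hS', hT'⟩ := hin c hc z hz1 hz2
    exact ⟨hS.trans hS', hT.trans hT'⟩

end AFEnd

/-- **`ChruscielDelay_parametricAnnulusGluing` from its coordinate core `(A)`** (Chruściel–Delay
2003, Thm. 5.9 / Prop. 5.10 / Cor. 5.11 with §8.6, and 2004, Thm. 6.6, in one chart on an annulus
of `E3`; see the module docstring): for every jointly smooth one-parameter family `(S c, T c)` of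
smooth symmetric coordinate data on `A = {R₁ < ‖z‖ < R₂}` (`0 < R₁ < R₂`), `S c` positive definite,
solving the coordinate vacuum constraints on `A`, with `(S 0, T 0)` free of coordinate KIDs on `A`,
there are `r > 0`, `R₁ < ρ₁ < ρ₂ < R₂` and a family `(S' c, T' c)` jointly `C^∞` on `ball 0 r × A`,
symmetric, positive, coordinate-vacuum on `A`, through `(S 0, T 0)`, `= (S c, T c)` on
`{R₁ < ‖z‖ < ρ₁}` and `= (S 0, T 0)` on `{ρ₂ < ‖z‖ < R₂}`. `b₀` is any basis of `E3` (the
coordinate momentum constraint is written in a basis). `(A)` is NOT proved in the tree (weighted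
Sobolev/Hölder theory on the compact annulus, the isomorphism `P Φ² ψ² P*`, regularity up to the
boundary, the Banach inverse function theorem with `C^∞` parameter dependence); this theorem
records that nothing beyond it is needed. [cite: ChruscielDelay2003, Thm. 5.9, Prop. 5.10, Cor. 5.11 and §8.6] -/
theorem ChruscielDelay_parametricAnnulusGluing_of_coordCore {ι : Type} [Fintype ι]
    (b₀ : Basis ι ℝ E3)
    (hA : ∀ (R₁ R₂ : ℝ), 0 < R₁ → R₁ < R₂ →
      ∀ (S T : EuclideanSpace ℝ (Fin 1) → E3 → E3 →L[ℝ] E3 →L[ℝ] ℝ),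
        ContDiffOn ℝ ∞ (fun p : EuclideanSpace ℝ (Fin 1) × E3 ↦ S p.1 p.2)
          ((univ : Set (EuclideanSpace ℝ (Fin 1))) ×ˢ {z : E3 | R₁ < ‖z‖ ∧ ‖z‖ < R₂}) →
        ContDiffOn ℝ ∞ (fun p : EuclideanSpace ℝ (Fin 1) × E3 ↦ T p.1 p.2)
          ((univ : Set (EuclideanSpace ℝ (Fin 1))) ×ˢ {z : E3 | R₁ < ‖z‖ ∧ ‖z‖ < R₂}) →
        (∀ c, ∀ z : E3, R₁ < ‖z‖ → ‖z‖ < R₂ → ∀ v w : E3,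
          S c z v w = S c z w v ∧ T c z v w = T c z w v) →
        (∀ c, ∀ z : E3, R₁ < ‖z‖ → ‖z‖ < R₂ → ∀ v : E3, v ≠ 0 → 0 < S c z v v) →
        (∀ c, ∀ z : E3, R₁ < ‖z‖ → ‖z‖ < R₂ →
          MetricCoord.hamAt (S c) (T c) z = 0 ∧
            ∀ Z : E3, MetricCoord.momFn b₀ (S c) (T c) z Z = 0) →
        (∀ (N : E3 → ℝ) (Y : E3 → E3),
          ContDiffOn ℝ ∞ N {z : E3 | R₁ < ‖z‖ ∧ ‖z‖ < R₂} →
          ContDiffOn ℝ ∞ Y {z : E3 | R₁ < ‖z‖ ∧ ‖z‖ < R₂} →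
          (∀ z : E3, R₁ < ‖z‖ → ‖z‖ < R₂ →
            MetricCoord.adjHamG (S 0) (T 0) N z + MetricCoord.adjMomGS (S 0) (T 0) Y z = 0 ∧
            MetricCoord.adjHamK (S 0) (T 0) N z + MetricCoord.adjMomKS (S 0) Y z = 0) →
          ∀ z : E3, R₁ < ‖z‖ → ‖z‖ < R₂ → N z = 0 ∧ Y z = 0) →
        ∃ (r ρ₁ ρ₂ : ℝ) (S' T' : EuclideanSpace ℝ (Fin 1) → E3 → E3 →L[ℝ] E3 →L[ℝ] ℝ),
          0 < r ∧ R₁ < ρ₁ ∧ ρ₁ < ρ₂ ∧ ρ₂ < R₂ ∧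
          ContDiffOn ℝ ∞ (fun p : EuclideanSpace ℝ (Fin 1) × E3 ↦ S' p.1 p.2)
            (ball (0 : EuclideanSpace ℝ (Fin 1)) r ×ˢ {z : E3 | R₁ < ‖z‖ ∧ ‖z‖ < R₂}) ∧
          ContDiffOn ℝ ∞ (fun p : EuclideanSpace ℝ (Fin 1) × E3 ↦ T' p.1 p.2)
            (ball (0 : EuclideanSpace ℝ (Fin 1)) r ×ˢ {z : E3 | R₁ < ‖z‖ ∧ ‖z‖ < R₂}) ∧
          (∀ c ∈ ball (0 : EuclideanSpace ℝ (Fin 1)) r, ∀ z : E3, R₁ < ‖z‖ → ‖z‖ < R₂ →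
            ∀ v w : E3, S' c z v w = S' c z w v ∧ T' c z v w = T' c z w v) ∧
          (∀ c ∈ ball (0 : EuclideanSpace ℝ (Fin 1)) r, ∀ z : E3, R₁ < ‖z‖ → ‖z‖ < R₂ →
            ∀ v : E3, v ≠ 0 → 0 < S' c z v v) ∧
          (∀ c ∈ ball (0 : EuclideanSpace ℝ (Fin 1)) r, ∀ z : E3, R₁ < ‖z‖ → ‖z‖ < R₂ →
            MetricCoord.hamAt (S' c) (T' c) z = 0 ∧
              ∀ Z : E3, MetricCoord.momFn b₀ (S' c) (T' c) z Z = 0) ∧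
          (∀ z : E3, R₁ < ‖z‖ → ‖z‖ < R₂ → S' 0 z = S 0 z ∧ T' 0 z = T 0 z) ∧
          (∀ c ∈ ball (0 : EuclideanSpace ℝ (Fin 1)) r, ∀ z : E3, R₁ < ‖z‖ → ‖z‖ < ρ₁ →
            S' c z = S c z ∧ T' c z = T c z) ∧
          (∀ c ∈ ball (0 : EuclideanSpace ℝ (Fin 1)) r, ∀ z : E3, ρ₂ < ‖z‖ → ‖z‖ < R₂ →
            S' c z = S 0 z ∧ T' c z = T 0 z)) :
    ChruscielDelay_parametricAnnulusGluing := by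
  refine ChruscielDelay_parametricAnnulusGluing_of_localFamily ?_
  intro X _ _ _ _ _ _ e D F R₁ R₂ hvac hF hF0 hFvac hR₁ hR₁₂ hKID
  subst hF0
  have hRr : ∀ {z : E3}, R₁ < ‖z‖ → e.R < ‖z‖ := fun hz ↦ lt_of_le_of_lt hR₁ hz
  -- the chart components of the family are coordinate data on the annulus, KID-free at `c = 0`
  obtain ⟨r, ρ₁, ρ₂, S', T', hr, h₁, h₂, h₃, hS's, hT's, hsym, hpos, hcv, h0, hin, hout⟩ :=
    hA R₁ R₂ (lt_of_lt_of_le e.R_pos hR₁) hR₁₂ (fun c z ↦ e.hCoeff (F c) z)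
      (fun c z ↦ e.kCoeff (F c) z)
      ((e.contDiffOn_hCoeff_family hF).mono
        (prod_mono Subset.rfl fun z (hz : R₁ < ‖z‖ ∧ ‖z‖ < R₂) ↦ hRr hz.1))
      ((e.contDiffOn_kCoeff_family hF).mono
        (prod_mono Subset.rfl fun z (hz : R₁ < ‖z‖ ∧ ‖z‖ < R₂) ↦ hRr hz.1))
      (fun c z _ _ v w ↦ ⟨AFEnd.hCoeff_symm e (F c) z v w, AFEnd.kCoeff_symm e (F c) z v w⟩)
      (fun c z hz _ v hv ↦ e.hCoeff_pos' (F c) (hRr hz) v hv)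
      (fun c z hz _ ↦ e.coordVacuum_of_isVacuum (F c) (hFvac c) b₀ (hRr hz))
      (by
        intro N Y hN hY heq z hz1 hz2
        by_contra hne
        exact hKID ⟨N, Y, hN, hY, ⟨z, hz1, hz2, not_and_or.1 hne⟩, heq⟩)
  -- glue with the chart components of `D = F 0` beyond `ρ₂`, then patch into `F c` beyond `R₁`
  obtain ⟨H, HK, hsm, hsym', hpos', hcv', hH0, hin', hout'⟩ :=
    e.exists_farCoordFamily_of_annulusFamily (F 0) hvac (fun c z ↦ e.hCoeff (F c) z)
      (fun c z ↦ e.kCoeff (F c) z) hR₁ h₁ h₂ h₃ hr b₀ S' T' hS's hT's hsym hpos hcv h0 hin hout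
  obtain ⟨G₀, hh, hk, hG0, hvacG, hnear, hfarD⟩ :=
    e.exists_localGluingFamily_of_farCoordFamily (F 0) F hF rfl hFvac hR₁ h₁ (h₁.trans h₂).le hr
      b₀ H HK hsm hsym' hpos' hcv' hH0 hin' hout'
  exact ⟨r, G₀, hr, hh, hk, hG0, hvacG, hnear, fun c hc x hx ↦ hfarD c hc x (e.far_mono h₃.le hx)⟩

end Literature.Geometry.Lorentzian

end
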